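import Summits.BirchSwinnertonDyer.BirchSwinnertonDyer.Theorems.Rank2ObservatoryOrderCert
import Mathlib.Data.ZMod.QuotientGroup
import Mathlib.GroupTheory.Coset.Card
import HarnessLib

/-!
# BirchSwinnertonDyer — rank ≥ 2 observatory: two-point order certificate (non-cyclic `Ẽ(𝔽_q)`)

HONEST FRAMING: per-curve certified theorems and census instruments; no claim on BSD in rank ≥ 2.

`Rank2ObservatoryOrderCert` certifies `#Ẽ(𝔽_q) = N` from ONE point of exact order `N > q + ½`,
which requires `Ẽ(𝔽_q)` to be cyclic. When `Ẽ(𝔽_q) ≅ ℤ/m × ℤ/r` (`r` prime, `r ∣ m` typically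
`r = 2`: full rational `2`-torsion mod `q`) no such point exists. The TWO-POINT certificate: a point
`G` of exact order `m`, a point `H ≠ 0` with `r • H = 0` and `H ∉ ℤG`, and `2q + 1 < 2mr`; then
`mr ∣ #Ẽ(𝔽_q)` (Lagrange in `Ẽ/ℤG`: the image of `H` has order `r`) and `#Ẽ(𝔽_q) ≤ 2q + 1`
(`zmodPointCount_le`, elementary) force `#Ẽ(𝔽_q) = mr`. No point counting, no Hasse bound.
`H ∉ ℤG` is KERNEL-CHECKABLE: if `r ∤ m` it is automatic (orders), and if `r ∣ m` it says
`H ≠ j • ((m/r) • G)` for `j < r` — for `r = 2`: `H ≠ (m/2) • G`; for `r = 3`: `H ≠ ±(m/3) • G`.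
Contents: `not_mem_zmultiples_of_forall_ne`, `not_mem_zmultiples_of_not_dvd`,
**`zmodPointCount_eq_of_orderCert₂`**, the Boolean **`orderCert2B V (q, N, X, Y, fs, r, X₂, Y₂)`**
(supports `r ∤ m`, `r = 2`, `r = 3`) and **`killerB_of_orderCert2B`** (drop-in like
`killerB_of_orderCertB`). Sorry-free; no `decide` executed in this file.

References: J. H. Silverman, *The Arithmetic of Elliptic Curves* (2009) V.1, III.2.3;
J. E. Cremona, *Algorithms for Modular Elliptic Curves* (1997) §2.4, §3.5.
-/

-- single-conjunct summit: `Summit.BirchSwinnertonDyer.BirchSwinnertonDyer.…` repeats the name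
set_option linter.dupNamespace false

namespace Summit.BirchSwinnertonDyer.BirchSwinnertonDyer.Rank2Observatory

open WeierstrassCurve

/-! ### `H ∉ ℤG`, checkably -/

section NotMem

variable {A : Type*} [AddCommGroup A]

/-- If `G` has order `m`, `r ∣ m`, `r • H = 0` and `H ≠ j • ((m / r) • G)` for every `j < r`, then
`H ∉ ℤG` (the `r`-torsion of `ℤG` is `{j • (m/r) • G}`). [folklore] -/
theorem not_mem_zmultiples_of_forall_ne {G H : A} {m r : ℕ} (hr : 0 < r) (hord : addOrderOf G = m)
    (hrm : r ∣ m) (hH : r • H = 0) (hne : ∀ j < r, H ≠ j • ((m / r) • G)) :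
    H ∉ AddSubgroup.zmultiples G := by
  intro hmem
  obtain ⟨k, hk⟩ := AddSubgroup.mem_zmultiples_iff.mp hmem
  obtain ⟨d, hd⟩ := hrm
  -- `m ∣ r k`
  have hdvd : (m : ℤ) ∣ (r : ℤ) * k := by
    rw [← hord, addOrderOf_dvd_iff_zsmul_eq_zero, mul_zsmul, hk, natCast_zsmul, hH]
  -- `d ∣ k`, `k = d * t`
  have hdk : (d : ℤ) ∣ k := by
    rw [hd, Nat.cast_mul] at hdvd
    exact Int.dvd_of_mul_dvd_mul_left (by exact_mod_cast hr.ne') hdvd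
  obtain ⟨t, rfl⟩ := hdk
  have hmd : m / r = d := by rw [hd, Nat.mul_div_cancel_left d hr]
  -- `t = j + r s` with `0 ≤ j < r`
  have hr0 : (r : ℤ) ≠ 0 := by exact_mod_cast hr.ne'
  set j := t % (r : ℤ) with hj
  set s := t / (r : ℤ) with hs
  have ht : t = j + (r : ℤ) * s := by rw [hj, hs]; linarith [Int.emod_add_mul_ediv t r]
  have hj0 : 0 ≤ j := Int.emod_nonneg t hr0
  have hjr : j < r := Int.emod_lt_of_pos t (by exact_mod_cast hr)
  have hmG : (m : ℤ) • G = 0 := by rw [natCast_zsmul, ← hord, addOrderOf_nsmul_eq_zero]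
  have hH' : H = j.toNat • ((m / r) • G) := by
    rw [← hk, ht, hmd, ← natCast_zsmul, ← natCast_zsmul, Int.toNat_of_nonneg hj0, smul_smul]
    have : (d : ℤ) * (j + (r : ℤ) * s) = j * (d : ℤ) + s * (m : ℤ) := by rw [hd]; push_cast; ring
    rw [this, add_zsmul, mul_zsmul, mul_zsmul, hmG, zsmul_zero, add_zero]
  exact hne j.toNat (by omega) hH'

/-- If `G` has order `m`, `r` is a prime NOT dividing `m`, `r • H = 0` and `H ≠ 0`, then `H ∉ ℤG`.
[folklore] -/
theorem not_mem_zmultiples_of_not_dvd {G H : A} {m r : ℕ} (hr : r.Prime) (hord : addOrderOf G = m)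
    (hrm : ¬ r ∣ m) (hH : r • H = 0) (hH0 : H ≠ 0) : H ∉ AddSubgroup.zmultiples G := by
  intro hmem
  haveI : Fact r.Prime := ⟨hr⟩
  have hoH : addOrderOf H = r := addOrderOf_eq_prime hH hH0
  have := addOrderOf_dvd_of_mem_zmultiples hmem
  rw [hoH, hord] at this
  exact hrm this

end NotMem

/-! ### Two points ⇒ the group order -/

section OrderCert2

variable (V : WeierstrassCurve ℤ) (q : ℕ) [Fact q.Prime]

/-- **Two-point Hasse-free order certificate.** If `q ∤ Δ`, `G` has exact order `m` (`m • G = 0`,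
`(m/s) • G ≠ 0` for primes `s ∣ m`), `r` is prime, `r • H = 0`, `H ≠ 0`, `H ∉ ℤG`, and
`2q + 1 < 2mr`, then `#Ẽ(𝔽_q) = mr`. [cite: SilvermanAEC2009, V.1] -/
theorem zmodPointCount_eq_of_orderCert₂ (hq : ¬ (q : ℤ) ∣ V.Δ)
    (G H : (V.map (Int.castRingHom (ZMod q))).toAffine.Point) {m r : ℕ} (hm : 0 < m)
    (hG : m • G = 0) (hdiv : ∀ s : ℕ, s.Prime → s ∣ m → (m / s) • G ≠ 0)
    (hr : r.Prime) (hH : r • H = 0) (hnot : H ∉ AddSubgroup.zmultiples G)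
    (hlt : 2 * q + 1 < 2 * (m * r)) : zmodPointCount V q = m * r := by
  classical
  have hord : addOrderOf G = m := addOrderOf_eq_of_nsmul_and_div_prime_nsmul hm hG hdiv
  set K := AddSubgroup.zmultiples G with hK
  have hcardK : Nat.card K = m := by rw [hK, Nat.card_zmultiples, hord]
  -- the image of `H` in the quotient has order `r`
  set x : _ ⧸ K := (H : _ ⧸ K) with hx
  have hx0 : x ≠ 0 := fun h => hnot ((QuotientAddGroup.eq_zero_iff H).mp h)
  have hrx : r • x = 0 := by rw [hx, ← QuotientAddGroup.mk_nsmul, hH, QuotientAddGroup.mk_zero]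
  haveI : Fact r.Prime := ⟨hr⟩
  have hox : addOrderOf x = r := addOrderOf_eq_prime hrx hx0
  have hrq : r ∣ Nat.card (_ ⧸ K) := hox ▸ addOrderOf_dvd_natCard x
  have hcard := natCard_point_eq_zmodPointCount V q hq
  have hdvd : m * r ∣ zmodPointCount V q := by
    rw [← hcard, AddSubgroup.card_eq_card_quotient_mul_card_addSubgroup K, hcardK, mul_comm]
    exact Nat.mul_dvd_mul hrq (dvd_refl m)
  have hle : zmodPointCount V q ≤ 2 * q + 1 := zmodPointCount_le V
  obtain ⟨j, hj⟩ := hdvd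
  have hpos : 0 < zmodPointCount V q := by unfold zmodPointCount; omega
  have hj1 : j = 1 := by
    rcases j with _ | _ | j
    · omega
    · rfl
    · nlinarith
  rw [hj, hj1, mul_one]

end OrderCert2

/-! ### The two-point certificate killer -/

section Killer

/-- TWO-POINT ORDER CERTIFICATE for the killer `(ℓ, N)` (a Boolean for `decide`), data
`(ℓ, N, X, Y, fs, r, X₂, Y₂)`: `ℓ` a good prime, `2ℓ + 1 < 2N`, `r` prime with `r ∣ N`,
`m := N / r`;
`G = (X, Y)` on `V mod ℓ` with `(m − 1) • G = −G` and `(m / s) • G` affine for the listed complete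
prime factorisation `m = ∏ s ^ e`; `H = (X₂, Y₂)` on the curve with `(r − 1) • H = −H`; and
`H ∉ ℤG`:
either `r ∤ m`, or `P₀ := (m / r) • G` is affine, `H ≠ P₀`, and (`r = 2`, or `r = 3` and `H ≠ −P₀`).
[cite: SilvermanAEC2009, V.1] -/
def orderCert2B (V : WeierstrassCurve ℤ) : ℕ × ℕ × ℤ × ℤ × List (ℕ × ℕ) × ℕ × ℤ × ℤ → Bool
  | (0, _) => false
  | (ℓ + 1, N, X, Y, fs, r, X₂, Y₂) =>
    let m := N / r
    goodPrimeTB V (ℓ + 1) &&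
    decide (2 * (ℓ + 1) + 1 < 2 * N) && primeTDB r && decide (N % r = 0) &&
    decide ((Y : ZMod (ℓ + 1)) ^ 2 + (V.a₁ : ZMod (ℓ + 1)) * X * Y + (V.a₃ : ZMod (ℓ + 1)) * Y =
      (X : ZMod (ℓ + 1)) ^ 3 + (V.a₂ : ZMod (ℓ + 1)) * X ^ 2 + (V.a₄ : ZMod (ℓ + 1)) * X
        + (V.a₆ : ZMod (ℓ + 1))) &&
    decide (multPointC V (ℓ + 1) ((X : ZMod (ℓ + 1)), (Y : ZMod (ℓ + 1))) (m - 1) =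
      some ((X : ZMod (ℓ + 1)),
        -(Y : ZMod (ℓ + 1)) - (V.a₁ : ZMod (ℓ + 1)) * X - (V.a₃ : ZMod (ℓ + 1)))) &&
    fs.all (fun se => primeTDB se.1 &&
      (multPointC V (ℓ + 1) ((X : ZMod (ℓ + 1)), (Y : ZMod (ℓ + 1))) (m / se.1)).isSome) &&
    decide (m = (fs.map fun se => se.1 ^ se.2).prod) &&
    decide ((Y₂ : ZMod (ℓ + 1)) ^ 2 + (V.a₁ : ZMod (ℓ + 1)) * X₂ * Y₂ + (V.a₃ : ZMod (ℓ + 1)) * Y₂ =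
      (X₂ : ZMod (ℓ + 1)) ^ 3 + (V.a₂ : ZMod (ℓ + 1)) * X₂ ^ 2 + (V.a₄ : ZMod (ℓ + 1)) * X₂
        + (V.a₆ : ZMod (ℓ + 1))) &&
    decide (multPointC V (ℓ + 1) ((X₂ : ZMod (ℓ + 1)), (Y₂ : ZMod (ℓ + 1))) (r - 1) =
      some ((X₂ : ZMod (ℓ + 1)),
        -(Y₂ : ZMod (ℓ + 1)) - (V.a₁ : ZMod (ℓ + 1)) * X₂ - (V.a₃ : ZMod (ℓ + 1)))) &&
    (decide (m % r ≠ 0) ||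
      match multPointC V (ℓ + 1) ((X : ZMod (ℓ + 1)), (Y : ZMod (ℓ + 1))) (m / r) with
      | none => false
      | some P₀ =>
        decide (((X₂ : ZMod (ℓ + 1)), (Y₂ : ZMod (ℓ + 1))) ≠ P₀) &&
        (decide (r = 2) || (decide (r = 3) &&
          decide (((X₂ : ZMod (ℓ + 1)), (Y₂ : ZMod (ℓ + 1))) ≠
            (P₀.1, -P₀.2 - (V.a₁ : ZMod (ℓ + 1)) * P₀.1 - (V.a₃ : ZMod (ℓ + 1)))))))

/-- **`orderCert2B ⇒ killerB`**: a checked two-point certificate gives the landed killer Boolean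
(same prime, same count). [cite: SilvermanAEC2009, V.1] -/
theorem killerB_of_orderCert2B (V : WeierstrassCurve ℤ)
    {c : ℕ × ℕ × ℤ × ℤ × List (ℕ × ℕ) × ℕ × ℤ × ℤ}
    (h : orderCert2B V c = true) : killerB V (c.1, c.2.1) = true := by
  obtain ⟨ℓ, N, X, Y, fs, r, X₂, Y₂⟩ := c
  cases ℓ with
  | zero => simp [orderCert2B] at h
  | succ ℓ =>
    simp only [orderCert2B, Bool.and_eq_true, decide_eq_true_eq, List.all_eq_true,
      Option.isSome_iff_exists] at h
    obtain ⟨⟨⟨⟨⟨⟨⟨⟨⟨⟨hgood, hlt⟩, hrp⟩, hrN⟩, he⟩, hneg⟩, hfs⟩, hm⟩, he₂⟩, hneg₂⟩, hex⟩ := h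
    have hgood' := goodPrimeB_of_goodPrimeTB V hgood
    have hg2 := hgood'
    rw [goodPrimeB, Bool.and_eq_true, decide_eq_true_eq, decide_eq_true_eq] at hg2
    obtain ⟨hprime, hΔ⟩ := hg2
    haveI : Fact (ℓ + 1).Prime := ⟨hprime⟩
    have hr : r.Prime := prime_of_primeTDB hrp
    set m := N / r with hmdef
    have hNmr : N = m * r := by
      rw [hmdef]; exact (Nat.div_mul_cancel (Nat.dvd_of_mod_eq_zero hrN)).symm
    -- the two base points
    set W := V.map (Int.castRingHom (ZMod (ℓ + 1))) with hW
    have hE : W.toAffine.Equation (X : ZMod (ℓ + 1)) (Y : ZMod (ℓ + 1)) := by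
      rw [Affine.equation_iff]
      simpa [hW, WeierstrassCurve.map] using he
    have hns : W.toAffine.Nonsingular (X : ZMod (ℓ + 1)) (Y : ZMod (ℓ + 1)) :=
      (Affine.equation_iff_nonsingular_of_Δ_ne_zero (Δ_zmod_ne_zero V (ℓ + 1) hΔ)).mp hE
    have hE₂ : W.toAffine.Equation (X₂ : ZMod (ℓ + 1)) (Y₂ : ZMod (ℓ + 1)) := by
      rw [Affine.equation_iff]
      simpa [hW, WeierstrassCurve.map] using he₂
    have hns₂ : W.toAffine.Nonsingular (X₂ : ZMod (ℓ + 1)) (Y₂ : ZMod (ℓ + 1)) :=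
      (Affine.equation_iff_nonsingular_of_Δ_ne_zero (Δ_zmod_ne_zero V (ℓ + 1) hΔ)).mp hE₂
    set G : W.toAffine.Point := .some _ _ hns with hGdef
    set H : W.toAffine.Point := .some _ _ hns₂ with hHdef
    -- `m • G = 0` and `r • H = 0` from the `(n − 1)`-chains
    have hmpos : 0 < m := by
      rcases Nat.eq_zero_or_pos m with h0 | h0
      · rw [h0, zero_mul] at hNmr; omega
      · exact h0
    obtain ⟨hP, eP⟩ := exists_nsmul_eq_of_multPointC V (ℓ + 1)
      (g := ((X : ZMod (ℓ + 1)), (Y : ZMod (ℓ + 1)))) hns hneg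
    have hnegG : -G = .some (X : ZMod (ℓ + 1))
        (-(Y : ZMod (ℓ + 1)) - (V.a₁ : ZMod (ℓ + 1)) * X - (V.a₃ : ZMod (ℓ + 1))) hP := by
      rw [hGdef, Affine.Point.neg_some]
      congr 1
    have hm1 : (m - 1) • G = -G := by rw [hnegG]; exact eP
    have hmG : m • G = 0 := by
      have : m = (m - 1) + 1 := by omega
      rw [this, succ_nsmul, hm1, neg_add_cancel]
    obtain ⟨hP₂, eP₂⟩ := exists_nsmul_eq_of_multPointC V (ℓ + 1)
      (g := ((X₂ : ZMod (ℓ + 1)), (Y₂ : ZMod (ℓ + 1)))) hns₂ hneg₂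
    have hnegH : -H = .some (X₂ : ZMod (ℓ + 1))
        (-(Y₂ : ZMod (ℓ + 1)) - (V.a₁ : ZMod (ℓ + 1)) * X₂ - (V.a₃ : ZMod (ℓ + 1))) hP₂ := by
      rw [hHdef, Affine.Point.neg_some]
      congr 1
    have hr1 : (r - 1) • H = -H := by rw [hnegH]; exact eP₂
    have hrH : r • H = 0 := by
      have : r = (r - 1) + 1 := by have := hr.two_le; omega
      rw [this, succ_nsmul, hr1, neg_add_cancel]
    have hH0 : H ≠ 0 := by rw [hHdef]; exact Affine.Point.some_ne_zero hns₂
    -- `(m / s) • G ≠ 0` for every prime `s ∣ m`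
    have hdiv : ∀ s : ℕ, s.Prime → s ∣ m → (m / s) • G ≠ 0 := by
      intro s hs hsm
      rw [hm] at hsm
      obtain ⟨a, ha, hsa⟩ := (Prime.dvd_prod_iff hs.prime).mp hsm
      obtain ⟨se, hse, rfl⟩ := List.mem_map.mp ha
      obtain ⟨hps, P', hP'⟩ := hfs se hse
      have hs' : s = se.1 :=
        (Nat.prime_dvd_prime_iff_eq hs (prime_of_primeTDB hps)).mp (hs.dvd_of_dvd_pow hsa)
      obtain ⟨hP'', e''⟩ := exists_nsmul_eq_of_multPointC V (ℓ + 1)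
        (g := ((X : ZMod (ℓ + 1)), (Y : ZMod (ℓ + 1)))) hns hP'
      rw [hs', ← hGdef] at *
      rw [e'']
      exact Affine.Point.some_ne_zero hP''
    have hord : addOrderOf G = m := addOrderOf_eq_of_nsmul_and_div_prime_nsmul hmpos hmG hdiv
    -- `H ∉ ℤG`
    have hnot : H ∉ AddSubgroup.zmultiples G := by
      rw [Bool.or_eq_true, decide_eq_true_eq] at hex
      rcases hex with hndvd | hex
      · exact not_mem_zmultiples_of_not_dvd hr hord
          (fun hd => hndvd (Nat.mod_eq_zero_of_dvd hd)) hrH hH0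
      · cases hP0 : multPointC V (ℓ + 1) ((X : ZMod (ℓ + 1)), (Y : ZMod (ℓ + 1))) (m / r) with
        | none => simp [hP0] at hex
        | some P₀ =>
          simp only [hP0, Bool.and_eq_true, Bool.or_eq_true, decide_eq_true_eq] at hex
          obtain ⟨hne1, hr23⟩ := hex
          obtain ⟨hP₀, e₀⟩ := exists_nsmul_eq_of_multPointC V (ℓ + 1)
            (g := ((X : ZMod (ℓ + 1)), (Y : ZMod (ℓ + 1)))) hns hP0
          rw [← hGdef] at e₀
          by_cases hrm : r ∣ m
          · refine not_mem_zmultiples_of_forall_ne hr.pos hord hrm hrH ?_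
            -- `r • P₀ = m • G = 0`, so `2 • P₀ = -P₀` when `r = 3`
            have hrP₀ : r • ((m / r) • G) = 0 := by
              rw [← mul_nsmul', Nat.mul_div_cancel' hrm]  -- r * (m / r) = m
              exact hmG
            intro j hj hHj
            rcases hr23 with rfl | ⟨rfl, hne2⟩
            · -- r = 2: j = 0 or 1
              interval_cases j
              · rw [zero_nsmul] at hHj; exact hH0 hHj
              · rw [one_nsmul, e₀, hHdef] at hHj
                exact hne1 (by
                  have := (Affine.Point.some.injEq _ _ _ _ _ _).mp hHj
                  exact Prod.ext this.1 this.2)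
            · -- r = 3: j = 0, 1, 2 with 2 • P₀ = -P₀
              interval_cases j
              · rw [zero_nsmul] at hHj; exact hH0 hHj
              · rw [one_nsmul, e₀, hHdef] at hHj
                exact hne1 (by
                  have := (Affine.Point.some.injEq _ _ _ _ _ _).mp hHj
                  exact Prod.ext this.1 this.2)
              · have h2 : 2 • ((m / 3) • G) = -((m / 3) • G) := by
                  have h3 : 3 • ((m / 3) • G) = 0 := hrP₀
                  rw [show 3 • ((m / 3) • G) = 2 • ((m / 3) • G) + (m / 3) • G from succ_nsmul _ 2]
                    at h3
                  exact eq_neg_of_add_eq_zero_left h3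
                rw [h2, e₀, Affine.Point.neg_some, hHdef] at hHj
                exact hne2 (by
                  have := (Affine.Point.some.injEq _ _ _ _ _ _).mp hHj
                  exact Prod.ext this.1 this.2)
          · exact not_mem_zmultiples_of_not_dvd hr hord hrm hrH hH0
    have hlt' : 2 * (ℓ + 1) + 1 < 2 * (m * r) := by rw [← hNmr]; exact hlt
    have hcount : zmodPointCount V (ℓ + 1) = m * r :=
      zmodPointCount_eq_of_orderCert₂ V (ℓ + 1) hΔ G H hmpos hmG hdiv hr hrH hnot hlt'
    rw [killerB, Bool.and_eq_true]
    refine ⟨hgood', ?_⟩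
    rw [beq_iff_eq]
    show zmodPointCount V (ℓ + 1) = N
    rw [hcount, hNmr]

/-- List form: `S.all (orderCert2B V) ⇒ (S.map ⋯).all (killerB V)`. [folklore] -/
theorem all_killerB_of_all_orderCert2B (V : WeierstrassCurve ℤ)
    {S : List (ℕ × ℕ × ℤ × ℤ × List (ℕ × ℕ) × ℕ × ℤ × ℤ)} (h : S.all (orderCert2B V) = true) :
    (S.map fun c => (c.1, c.2.1)).all (killerB V) = true := by
  rw [List.all_eq_true] at h ⊢
  intro x hx
  obtain ⟨c, hc, rfl⟩ := List.mem_map.mp hx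
  exact killerB_of_orderCert2B V (h c hc)

end Killer

end Summit.BirchSwinnertonDyer.BirchSwinnertonDyer.Rank2Observatory
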